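import Summits.CriticalPhenomena.PercolationContinuityZ3.Theorems.PercNearOneGluingNoHeavyRsw3InvasionGreedy
import Literature.Probability.Percolation.InvasionPercolationTree
import HarnessLib

/-!
# RSW3 lane (P2, gen 29): INVASION PERCOLATION XXVIII — THE OUTLETS OF AN INVASION AS FUTURE MAXIMA OF THE ACCEPTED LABELS:
# existence beyond every time from `limsup < sup`, strictly decreasing labels, and the GREEDY SEPARATION LEMMA
# (after an outlet, every later bond is attached OUTSIDE the region invaded up to the outlet) — every graph, every label field

builds on p205010 (kernel theorem, internal audit signed; external expert review pending) — NOT used in this file (deterministic).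

Cell `prim-rsw3`, prover seat `prim-rsw3-p2` (gen 29), memo `run/shared/lean/prim/rsw3/P2-RSWLITE.md` §36.  Support file
(`--supports stmt-CriticalPhenomena-4575`); no definitions, no named facts, no sorries.  Notation: `I_n = invasion G U o n`, `x_n = acceptedLabel G U o n`,
outlet step `IsOutlet G U o m :⟺ ∀ n > m, x_n < x_m` (`Literature/Probability/Percolation/InvasionPercolationTree.lean`).

This is the deterministic half of the first paragraph of the proof of Lyons–Peres–Schramm 2006, Thm. 3.12 ("For each `k` such that
`U(e_k) = sup_{n ≥ k} U(e_n)`, the edge `e_k` separates `o` from `∞` in the invasion tree of `o`") and of the pond–outlet construction of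
Damron–Sapozhnikov–Vágvölgyi 2009, §1.1 (`τ̂_1 = max` of all invaded labels "exists and is greater than `p_c`", `ê_1` the bond attaining it, `τ̂_2` the
maximum after `ê_1`, …):

* §1 `exists_record_of_lt_of_eventually_le` — a real sequence that exceeds `y` at some time `n₀ ≥ k` and is eventually `≤ y` has a STRICT future
  maximum at some `m ≥ k` (`x_n < x_m` for all `n > m`, `x_n ≤ x_m` for all `n ≥ k`, and `y < x_m`): the last maximiser over the finite window does it.
* §2 `exists_isOutlet_of_lt_of_eventually_le`, **`forall_exists_isOutlet`** — if `x_n > p` infinitely often and, for every `y > p`, `x_n ≤ y`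
  eventually (i.e. `limsup x_n = p` is approached from above infinitely often), then there are outlet steps beyond every time, all with label `> p`
  (`lt_acceptedLabel_of_isOutlet`), with labels strictly decreasing (`IsOutlet.acceptedLabel_lt`, defs file) and squeezed to `p`
  (`eventually_isOutlet_acceptedLabel_le`).
* §3 THE GREEDY SEPARATION LEMMA **`fst_not_mem_invasion_of_isOutlet`** — if `m` is an outlet then every dart absorbed at a time `n > m` has its
  inner endpoint OUTSIDE `I_m` (were it inside, the dart would be a boundary dart of `I_m`, whose labels are all `≥ x_m > x_n`); with the trivial
  facts that darts absorbed before `m` lie inside `I_m` (`fst_mem_invasion_of_lt`, `snd_mem_invasion_of_lt`) and the outlet dart straddles `I_m`, this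
  is the trichotomy behind "the outlet separates `o` from `∞`" (next file).
* §4 `eq_of_newDart_sym2_eq` — a bond is absorbed at most once (the step of a tree edge is well defined).

References: R. Lyons, Y. Peres, O. Schramm, Ann. Probab. 34 (2006) 1665–1692, Thm. 3.12 (proof) [LyonsPeresSchramm2006]; R. Lyons, Y. Peres,
*Probability on Trees and Networks* (2016), Thm. 11.12 [LyonsPeres2016]; M. Damron, A. Sapozhnikov, B. Vágvölgyi, Ann. Probab. 37 (2009) 2297–2331, §1.1;
J. T. Chayes, L. Chayes, C. M. Newman, Comm. Math. Phys. 101 (1985) §2 [ChayesChayesNewman1985].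
-/

noncomputable section

namespace Summit.CriticalPhenomena.PercolationContinuityZ3.Theorems.Rsw3

open Finset Filter Literature.Probability.Percolation Literature.Probability.Percolation.Invasion

/-! ## §1 Strict future maxima of a real sequence -/

/-- **Record lemma.** If a real sequence exceeds `y` at some time `n₀ ≥ k` and is eventually `≤ y`, then it has a strict future maximum at some
time `m ≥ k`: `y < x m`, `x n < x m` for every `n > m`, and `x n ≤ x m` for every `n ≥ k` (take the LAST maximiser of `x` on the finite window
`[k, N)` beyond which `x ≤ y`).
[cite: LyonsPeresSchramm2006, Thm. 3.12 (proof: the indices k with U(e_k) = sup over n ≥ k)] -/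
theorem exists_record_of_lt_of_eventually_le {x : ℕ → ℝ} {k n₀ : ℕ} {y : ℝ} (hk : k ≤ n₀) (hy : y < x n₀)
    (hev : ∀ᶠ n in atTop, x n ≤ y) :
    ∃ m, k ≤ m ∧ y < x m ∧ (∀ n, m < n → x n < x m) ∧ ∀ n, k ≤ n → x n ≤ x m := by
  obtain ⟨N, hN⟩ := eventually_atTop.1 hev
  have hn₀N : n₀ < N := lt_of_not_ge fun h => (hN n₀ h).not_gt hy
  have hn₀I : n₀ ∈ Finset.Ico k N := Finset.mem_Ico.2 ⟨hk, hn₀N⟩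
  obtain ⟨m₁, hm₁, hmax⟩ := (Finset.Ico k N).exists_max_image x ⟨n₀, hn₀I⟩
  set S : Finset ℕ := (Finset.Ico k N).filter fun n => x n = x m₁ with hS
  have hSne : S.Nonempty := ⟨m₁, by simp [hS, hm₁]⟩
  have hm := Finset.max'_mem S hSne
  simp only [hS, Finset.mem_filter, Finset.mem_Ico] at hm
  refine ⟨S.max' hSne, hm.1.1, ?_, fun n hn => ?_, fun n hn => ?_⟩
  · rw [hm.2]; exact hy.trans_le (hmax n₀ hn₀I)
  · by_cases hnN : n < N
    · have hnI : n ∈ Finset.Ico k N := Finset.mem_Ico.2 ⟨hm.1.1.trans hn.le, hnN⟩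
      rcases (hmax n hnI).lt_or_eq with hlt | heq
      · rwa [hm.2]
      · have hnS : n ∈ S := by simp [hS, hnI, heq]
        exact absurd (Finset.le_max' S n hnS) (not_le.2 hn)
    · rw [hm.2]
      exact (hN n (not_lt.1 hnN)).trans_lt (hy.trans_le (hmax n₀ hn₀I))
  · rw [hm.2]
    by_cases hnN : n < N
    · exact hmax n (Finset.mem_Ico.2 ⟨hn, hnN⟩)
    · exact (hN n (not_lt.1 hnN)).trans (hy.trans_le (hmax n₀ hn₀I)).le

/-! ## §2 Outlets of the invasion exist beyond every time when the label sequence keeps rising above its limsup -/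

section General

variable {V : Type*} [DecidableEq V] {G : SimpleGraph V} [G.LocallyFinite]

/-- An accepted label `> y` at some time `n₀ ≥ k`, followed eventually by labels `≤ y`, yields an OUTLET at some time `m ≥ k` with label `> y`.
[cite: LyonsPeresSchramm2006, Thm. 3.12 (proof)] -/
theorem exists_isOutlet_of_lt_of_eventually_le {U : Sym2 V → ℝ} {o : V} {k n₀ : ℕ} {y : ℝ} (hk : k ≤ n₀)
    (hy : y < acceptedLabel G U o n₀) (hev : ∀ᶠ n in atTop, acceptedLabel G U o n ≤ y) :
    ∃ m, k ≤ m ∧ IsOutlet G U o m ∧ y < acceptedLabel G U o m ∧ ∀ n, k ≤ n → acceptedLabel G U o n ≤ acceptedLabel G U o m := by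
  obtain ⟨m, hkm, hym, hrec, hmax⟩ := exists_record_of_lt_of_eventually_le hk hy hev
  exact ⟨m, hkm, hrec, hym, hmax⟩

/-- **Outlets beyond every time.**  If the accepted labels exceed `p` infinitely often while, for every `y > p`, they are eventually `≤ y`
(so `limsup_n x_n = p`, attained from above infinitely often — on `ℤ^d` at `p = p_c` this is CCN's Thm 3.2 plus `θ(p_c) = 0`), then for every `k`
there is an outlet step `m ≥ k`, and its label is `> p`. [cite: LyonsPeresSchramm2006, Thm. 3.12 (proof, first paragraph)] -/
theorem forall_exists_isOutlet {U : Sym2 V → ℝ} {o : V} {p : ℝ} (hfreq : ∃ᶠ n in atTop, p < acceptedLabel G U o n)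
    (hev : ∀ y, p < y → ∀ᶠ n in atTop, acceptedLabel G U o n ≤ y) (k : ℕ) :
    ∃ m, k ≤ m ∧ IsOutlet G U o m ∧ p < acceptedLabel G U o m := by
  obtain ⟨n₀, hn₀, hp⟩ := frequently_atTop.1 hfreq k
  have hmid : p < (p + acceptedLabel G U o n₀) / 2 := by linarith
  have hmid' : (p + acceptedLabel G U o n₀) / 2 < acceptedLabel G U o n₀ := by linarith
  obtain ⟨m, hkm, hout, hym, -⟩ := exists_isOutlet_of_lt_of_eventually_le hn₀ hmid' (hev _ hmid)
  exact ⟨m, hkm, hout, hmid.trans hym⟩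

/-- **The first outlet carries the LARGEST label ever accepted** (`τ̂_1 = max_n x_n` is attained): under the same hypotheses there is an outlet
step `m` with `x_n ≤ x_m` for every `n`, no earlier step is an outlet, and `x_m > p`. [cite: LyonsPeresSchramm2006, Thm. 3.12 (proof)] -/
theorem exists_isOutlet_forall_acceptedLabel_le {U : Sym2 V → ℝ} {o : V} {p : ℝ} (hfreq : ∃ᶠ n in atTop, p < acceptedLabel G U o n)
    (hev : ∀ y, p < y → ∀ᶠ n in atTop, acceptedLabel G U o n ≤ y) :
    ∃ m, IsOutlet G U o m ∧ p < acceptedLabel G U o m ∧ (∀ n, acceptedLabel G U o n ≤ acceptedLabel G U o m) ∧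
      ∀ m', m' < m → ¬ IsOutlet G U o m' := by
  obtain ⟨n₀, -, hp⟩ := frequently_atTop.1 hfreq 0
  have hmid : p < (p + acceptedLabel G U o n₀) / 2 := by linarith
  have hmid' : (p + acceptedLabel G U o n₀) / 2 < acceptedLabel G U o n₀ := by linarith
  obtain ⟨m, -, hout, hym, hmax⟩ := exists_isOutlet_of_lt_of_eventually_le (Nat.zero_le n₀) hmid' (hev _ hmid)
  refine ⟨m, hout, hmid.trans hym, fun n => hmax n (Nat.zero_le n), fun m' hm' hout' => ?_⟩
  exact absurd (hmax m' (Nat.zero_le m')) (not_le.2 (hout' m hm'))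

/-- The set of outlet steps is infinite under the hypotheses of `forall_exists_isOutlet`. [cite: LyonsPeresSchramm2006, Thm. 3.12 (proof)] -/
theorem setOf_isOutlet_infinite {U : Sym2 V → ℝ} {o : V} {p : ℝ} (hfreq : ∃ᶠ n in atTop, p < acceptedLabel G U o n)
    (hev : ∀ y, p < y → ∀ᶠ n in atTop, acceptedLabel G U o n ≤ y) : {m | IsOutlet G U o m}.Infinite := by
  refine Set.infinite_of_forall_exists_gt fun k => ?_
  obtain ⟨m, hkm, hout, -⟩ := forall_exists_isOutlet hfreq hev (k + 1)
  exact ⟨m, hout, Nat.lt_of_succ_le hkm⟩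

/-- **Every outlet label exceeds `p`** when labels `> p` are accepted infinitely often: some later label is `> p` and the outlet label beats it.
[cite: LyonsPeresSchramm2006, Thm. 3.12 (proof: sup over n ≥ k of U(e_n) > p_c)] -/
theorem lt_acceptedLabel_of_isOutlet {U : Sym2 V → ℝ} {o : V} {p : ℝ} {m : ℕ} (hm : IsOutlet G U o m)
    (hfreq : ∃ᶠ n in atTop, p < acceptedLabel G U o n) : p < acceptedLabel G U o m := by
  obtain ⟨n, hn, hp⟩ := frequently_atTop.1 hfreq (m + 1)
  exact hp.trans (hm n (Nat.lt_of_succ_le hn))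

/-- **The outlet labels are squeezed to `p` from above**: for every `y > p`, all outlets from some time on have label in `(p, y]`.  With
`IsOutlet.acceptedLabel_lt` (labels of outlets strictly decrease) the outlet labels `τ̂_1 > τ̂_2 > ⋯` converge to `p`.
[cite: LyonsPeresSchramm2006, Thm. 3.12 (proof: "the limsup of the labels along that end is equal to p_c")] -/
theorem eventually_isOutlet_acceptedLabel_le {U : Sym2 V → ℝ} {o : V} {p : ℝ} (hfreq : ∃ᶠ n in atTop, p < acceptedLabel G U o n)
    (hev : ∀ y, p < y → ∀ᶠ n in atTop, acceptedLabel G U o n ≤ y) {y : ℝ} (hy : p < y) :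
    ∀ᶠ m in atTop, IsOutlet G U o m → p < acceptedLabel G U o m ∧ acceptedLabel G U o m ≤ y := by
  filter_upwards [hev y hy] with m hm hout
  exact ⟨lt_acceptedLabel_of_isOutlet hout hfreq, hm⟩

/-- Two outlets: the later one has the smaller label (restated from the definitions file for the lane's readers).
[cite: LyonsPeresSchramm2006, Thm. 3.12 (proof)] -/
theorem acceptedLabel_lt_of_isOutlet_of_lt {U : Sym2 V → ℝ} {o : V} {m m' : ℕ} (hm : IsOutlet G U o m) (h : m < m') :
    acceptedLabel G U o m' < acceptedLabel G U o m :=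
  hm.acceptedLabel_lt G h

/-! ## §3 The greedy separation lemma: after an outlet, the invasion never again touches the region invaded up to the outlet -/

/-- Darts absorbed before time `m` start inside `I_m`. [cite: ChayesChayesNewman1985, §2 (the model)] -/
theorem fst_mem_invasion_of_lt {U : Sym2 V → ℝ} {o : V} {n m : ℕ} (h : n < m) {b : V × V}
    (hb : newDart G U (invasion G U o n) = some b) : b.1 ∈ invasion G U o m :=
  invasion_mono U o h.le (fst_mem_of_newDart hb)

/-- Darts absorbed before time `m` end inside `I_m` (the outer endpoint enters at time `n + 1 ≤ m`). [cite: ChayesChayesNewman1985, §2 (the model)] -/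
theorem snd_mem_invasion_of_lt {U : Sym2 V → ℝ} {o : V} {n m : ℕ} (h : n < m) {b : V × V}
    (hb : newDart G U (invasion G U o n) = some b) : b.2 ∈ invasion G U o m := by
  have h1 : b.2 ∈ invasion G U o (n + 1) := by
    rw [invasion_succ_of_newDart hb]; exact mem_insert_self _ _
  exact invasion_mono U o (Nat.succ_le_of_lt h) h1

/-- Darts absorbed at a time `n ≥ m` end outside `I_m`. [cite: ChayesChayesNewman1985, §2 (the model)] -/
theorem snd_not_mem_invasion_of_le {U : Sym2 V → ℝ} {o : V} {m n : ℕ} (h : m ≤ n) {b : V × V}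
    (hb : newDart G U (invasion G U o n) = some b) : b.2 ∉ invasion G U o m :=
  fun h2 => snd_not_mem_of_newDart hb (invasion_mono U o h h2)

/-- **Greedy separation lemma.**  If `m` is an outlet step, every dart absorbed at a later time `n > m` STARTS OUTSIDE `I_m`: otherwise it would
be a boundary dart of `I_m` (its outer endpoint is not even in `I_n ⊇ I_m`), and at time `m` the absorbed dart had the least label among the boundary
darts of `I_m`, so `x_m ≤ x_n` — contradicting `x_n < x_m`.  Hence after an outlet the invasion grows only off the vertices invaded after it.
[cite: LyonsPeresSchramm2006, Thm. 3.12 (proof: "e_k separates o from infinity in the invasion tree of o")] -/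
theorem fst_not_mem_invasion_of_isOutlet {U : Sym2 V → ℝ} {o : V} {m n : ℕ} (hm : IsOutlet G U o m) (hn : m < n) {b : V × V}
    (hb : newDart G U (invasion G U o n) = some b) : b.1 ∉ invasion G U o m := by
  intro h1
  have hbd : b ∈ boundaryDarts G (invasion G U o m) :=
    (mem_boundaryDarts G).2 ⟨h1, snd_not_mem_invasion_of_le hn.le hb, adj_of_newDart hb⟩
  have hle : acceptedLabel G U o m ≤ U s(b.1, b.2) := acceptedLabel_le_of_mem_boundaryDarts hbd
  rw [← acceptedLabel_of_eq_some G hb] at hle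
  exact absurd (hm n hn) (not_lt.2 hle)

/-- After an outlet `m`, both endpoints of every later absorbed dart lie outside `I_m`. [cite: LyonsPeresSchramm2006, Thm. 3.12 (proof)] -/
theorem not_mem_invasion_of_isOutlet_of_mem_sym2 {U : Sym2 V → ℝ} {o : V} {m n : ℕ} (hm : IsOutlet G U o m) (hn : m < n)
    {b : V × V} (hb : newDart G U (invasion G U o n) = some b) {v : V} (hv : v ∈ s(b.1, b.2)) : v ∉ invasion G U o m := by
  rcases Sym2.mem_iff.1 hv with rfl | rfl
  · exact fst_not_mem_invasion_of_isOutlet hm hn hb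
  · exact snd_not_mem_invasion_of_le hn.le hb

/-- Before time `m`, both endpoints of every absorbed dart lie inside `I_m`. [cite: ChayesChayesNewman1985, §2 (the model)] -/
theorem mem_invasion_of_lt_of_mem_sym2 {U : Sym2 V → ℝ} {o : V} {n m : ℕ} (h : n < m) {b : V × V}
    (hb : newDart G U (invasion G U o n) = some b) {v : V} (hv : v ∈ s(b.1, b.2)) : v ∈ invasion G U o m := by
  rcases Sym2.mem_iff.1 hv with rfl | rfl
  · exact fst_mem_invasion_of_lt h hb
  · exact snd_mem_invasion_of_lt h hb

/-- **The vertices invaded after an outlet are never adjacent (in the invasion tree) to `I_m` except through the outlet bond**: if a dart absorbed at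
time `n` has one endpoint in `I_m` and the other outside, then `n = m`. [cite: LyonsPeresSchramm2006, Thm. 3.12 (proof)] -/
theorem eq_of_isOutlet_of_mem_of_not_mem {U : Sym2 V → ℝ} {o : V} {m n : ℕ} (hm : IsOutlet G U o m) {b : V × V}
    (hb : newDart G U (invasion G U o n) = some b) {u w : V} (hu : u ∈ s(b.1, b.2)) (hw : w ∈ s(b.1, b.2))
    (huI : u ∈ invasion G U o m) (hwI : w ∉ invasion G U o m) : n = m := by
  rcases lt_trichotomy n m with hlt | rfl | hgt
  · exact absurd (mem_invasion_of_lt_of_mem_sym2 hlt hb hw) hwI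
  · rfl
  · exact absurd huI (not_mem_invasion_of_isOutlet_of_mem_sym2 hm hgt hb hu)

/-! ## §4 A bond is absorbed at most once -/

/-- **Each bond is absorbed at most once**: if the darts absorbed at times `n ≤ n'` carry the same bond then `n = n'` (at the later time both
endpoints of the earlier bond are already invaded, whereas the outer endpoint of an absorbed dart is new). [cite: ChayesChayesNewman1985, §2 (the model)] -/
theorem eq_of_newDart_sym2_eq {U : Sym2 V → ℝ} {o : V} {n n' : ℕ} {a a' : V × V} (ha : newDart G U (invasion G U o n) = some a)
    (ha' : newDart G U (invasion G U o n') = some a') (he : s(a.1, a.2) = s(a'.1, a'.2)) : n = n' := by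
  by_contra hne
  wlog hlt : n < n' generalizing n n' a a'
  · exact this ha' ha he.symm (Ne.symm hne) (lt_of_le_of_ne (not_lt.1 hlt) (Ne.symm hne))
  have h2 : a'.2 ∈ s(a.1, a.2) := by rw [he]; exact Sym2.mem_mk_right _ _
  exact snd_not_mem_of_newDart ha' (mem_invasion_of_lt_of_mem_sym2 hlt ha h2)

/-- The absorbed dart at a given time is unique (functionality of `newDart`, for rewriting). [folklore] -/
theorem newDart_some_inj {U : Sym2 V → ℝ} {I : Finset V} {a a' : V × V} (ha : newDart G U I = some a) (ha' : newDart G U I = some a') :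
    a = a' :=
  Option.some_injective _ (ha.symm.trans ha')

end General

end Summit.CriticalPhenomena.PercolationContinuityZ3.Theorems.Rsw3
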